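import Literature.NumberTheory.Automorphic.ParabolicInductionCutLevelProofs
import Literature.NumberTheory.Automorphic.JacquetLemma
import HarnessLib

/-!
# Harish-Chandra's support theorem on the Levi: quasi-cuspidal ⟹ compact coefficients
(sibling proof file towards `Literature.NumberTheory.Automorphic.bernsteinZelevinsky_support`)

Let `F` be a non-archimedean local field, `c : Fin n → Fin r` a monotone block labelling and
`M = Π_a GL(B_a, F)` the standard Levi. A smooth representation `τ` of `M` is *quasi-cuspidal at
the cuts* if for every proper cut `p | p+1` inside a block the coinvariants of `τ` under the cut
unipotent group `cutUnipotent F c p` vanish (hypothesis `hQC` below, produced for the cuspidal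
datum by `ParabolicInductionRefinementProofs`). This file proves **Harish-Chandra's theorem**
in the form needed for the supercuspidal support (Bernstein–Zelevinsky 1977, Thm. 2.5):

* `Representation.isSupercuspidal_of_forall_cut` — a smooth representation of `M` which is
  quasi-cuspidal at the cuts is supercuspidal in the sense of `Representation.IsSupercuspidal`:
  every smooth matrix coefficient `m ↦ φ (τ(m) w)` has support in `C · Z(M)` for a compact `C`.

This is Bernstein–Zelevinsky 1976, Thm. 3.21 / Harish-Chandra 1970 ("quasi-cuspidal ⟺ compact
modulo centre coefficients", direction ⟹) for the group `M`; Casselman 1995, Thm. 5.3.1 ff.,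
Thm. 6.3.5; Bushnell–Henniart 2006, §10.1 for `GL₂`. The proof formalised here:

1. (`exists_gap_forall_apply_eq_zero`) For smooth `φ` (in the contragredient) and any `w`,
   there is `G` such that `φ (τ(diag(ϖ^e)) w) = 0` whenever `e` is antitone on blocks and has a
   gap `≥ G` at some proper cut `p | p+1`: `w ∈ W(U) = ⋃_t W(U_t)` for the cut unipotent group `U`
   (`exists_mem_span_cutLevel_of_mem_coinvariantsKer`), `φ` is invariant under a deep level `U_s`
   (`exists_forall_apply_cutElem_eq`), and `diag(ϖ^e) U_t diag(ϖ^e)⁻¹ ⊆ U_{t + gap}`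
   (`cutScale_mem_cutLevel_of_gap`), so each generator `τ(u) y - y` of `W(U_t)` is killed by
   `φ ∘ τ(diag(ϖ^e))`. No Haar measure or averaging is needed.
2. (`exists_gap_uniform`) The `K₀`-orbits of `φ` and `w`, `K₀ = Π_a GL(B_a, 𝒪)`
   (`leviIntegral`), are finite (`finite_orbit_of_isSmoothVector` of `JacquetLemma`), so `G` can
   be chosen uniformly for the coefficients `φ (τ(k₁ diag(ϖ^e) k₂) w)`, `k₁, k₂ ∈ K₀`.
3. By the Cartan decomposition of `M` (`exists_leviIntegral_mul_leviZpowDiag_mul`) a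
   non-vanishing point of the coefficient is `k₁ diag(ϖ^e) k₂` with all gaps of `e` bounded by
   `G`; subtracting the block minima (a central element, `leviZpowDiag_mem_center`) leaves
   `e₀ ∈ [0, n G]^n`, a finite set, whence the compact set `C = K₀ · diag(ϖ^{E_fin}) · K₀`.

Theorems only, no new definitions, no named facts.

## References

* Harish-Chandra, *Harmonic analysis on reductive `p`-adic groups* (van Dijk's notes), LNM 162
  (1970), Part I §3.
* I. N. Bernstein, A. V. Zelevinsky, *Representations of the group `GL(n, F)` where `F` is a
  non-archimedean local field*, Russian Math. Surveys 31:3 (1976), §3 (3.18–3.21).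
* I. N. Bernstein, A. V. Zelevinsky, *Induced representations of reductive `p`-adic groups I*,
  Ann. Sci. ÉNS 10 (1977), §2.4–2.5.
* W. Casselman, *Introduction to the theory of admissible representations of `p`-adic reductive
  groups* (1995 notes), §5.3, §6.3.
* C. J. Bushnell, G. Henniart, *The local Langlands conjecture for `GL(2)`* (2006), §10.1.
-/

noncomputable section

open scoped MatrixGroups Topology Pointwise
open ValuativeRel

namespace Representation

open Literature.NumberTheory.Automorphic Literature.NumberTheory.Automorphic.JacquetLemma

variable {F : Type*} [Field F] [ValuativeRel F] [TopologicalSpace F] [IsNonarchimedeanLocalField F]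
  {n r : ℕ} {c : Fin n → Fin r} {W : Type*} [AddCommGroup W] [Module ℂ W]
  (τ : Representation ℂ (Π a, GL {i // c i = a} F) W)

/-! ### Step 1: vanishing for one pair `(φ, w)` -/

/-- **Vanishing of a coefficient at a diagonal element with a large gap.** Let `τ` be a
representation of the Levi `Π_a GL(B_a, F)` whose coinvariants under every proper cut unipotent
group vanish, `φ` a smooth linear form and `w` a vector. Then there is `G` such that
`φ (τ(diag(ϖ^e)) w) = 0` for every `e` antitone on blocks having a gap `e (p+1) + G ≤ e p` at some
proper cut `p | p+1`: writing `w` in `W(U_t)` for the cut unipotent group `U` of `p` and using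
the invariance of `φ` under a level `U_s`, each generator `τ(u) y - y` is killed by
`φ ∘ τ(diag(ϖ^e))` since `diag(ϖ^e) u diag(ϖ^e)⁻¹ ∈ U_{t + gap} ⊆ U_s`.
(Bernstein–Zelevinsky 1976, §3.18–3.20; Casselman 1995, proof of Thm. 5.3.1 / 6.3.5.)
[cite: BernsteinZelevinsky1976, §3.18–3.21] -/
theorem exists_gap_forall_apply_eq_zero {ϖ : F} (hϖ : IsUniformizingElement ϖ)
    (hQC : ∀ p q : Fin n, p < q → c q = c p →
      Coinvariants.ker (τ.comp (cutUnipotent F c p).subtype) = ⊤)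
    {φ : Module.Dual ℂ W} (hφ : φ ∈ τ.contragredient) (w : W) :
    ∃ G : ℤ, ∀ e : Fin n → ℤ, (∀ i j : Fin n, i ≤ j → c i = c j → e j ≤ e i) →
      ∀ (p : Fin n) (hp : p.1 + 1 < n), c ⟨p.1 + 1, hp⟩ = c p → e ⟨p.1 + 1, hp⟩ + G ≤ e p →
        φ (τ (leviZpowDiag c hϖ.ne_zero e) w) = 0 := by
  -- the level `j p` of `w` at each proper cut, and the level `t p` fixing `φ`
  have hj : ∀ p : Fin n, ∃ j : ℤ, ∀ hp : p.1 + 1 < n, c ⟨p.1 + 1, hp⟩ = c p →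
      w ∈ Submodule.span ℂ {y | ∃ X ∈ cutLevel c p ϖ j, ∃ v : W, y = τ (cutElem c p X) v - v} := by
    intro p
    by_cases h : ∃ hp : p.1 + 1 < n, c ⟨p.1 + 1, hp⟩ = c p
    · obtain ⟨hp, hcp⟩ := h
      have hw : w ∈ Coinvariants.ker (τ.comp (cutUnipotent F c p).subtype) := by
        rw [hQC p ⟨p.1 + 1, hp⟩ (Fin.lt_def.2 (Nat.lt_succ_self _)) hcp]
        trivial
      obtain ⟨j, hj⟩ := exists_mem_span_cutLevel_of_mem_coinvariantsKer c p hϖ τ hw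
      exact ⟨j, fun _ _ => hj⟩
    · exact ⟨0, fun hp hcp => absurd ⟨hp, hcp⟩ h⟩
  choose j hj using hj
  choose t ht using fun p : Fin n => exists_forall_apply_cutElem_eq c p hϖ τ hφ
  refine ⟨∑ p, |t p - j p|, fun e he p hp hcp hgap => ?_⟩
  -- the gap at `p` is at least `t p - j p`
  have hG : t p - j p ≤ ∑ q, |t q - j q| :=
    (le_abs_self _).trans (Finset.single_le_sum (f := fun q => |t q - j q|)
      (fun _ _ => abs_nonneg _) (Finset.mem_univ p))
  -- `φ ∘ τ(diag(ϖ^e))` kills the generators of `W(U_{j p})`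
  have hgap' : ∀ q : Fin n, p < q → c q = c p → e q + (t p - j p) ≤ e p := by
    intro q hq hcq
    have h1 : e q ≤ e ⟨p.1 + 1, hp⟩ :=
      he ⟨p.1 + 1, hp⟩ q (Fin.le_def.2 (Nat.succ_le_of_lt (Fin.lt_def.1 hq)))
        (hcp.trans hcq.symm)
    omega
  have hgen : ∀ y ∈ {y | ∃ X ∈ cutLevel c p ϖ (j p), ∃ v : W, y = τ (cutElem c p X) v - v},
      φ (τ (leviZpowDiag c hϖ.ne_zero e) y) = 0 := by
    rintro _ ⟨X, hX, v, rfl⟩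
    have hconj : leviZpowDiag c hϖ.ne_zero e * cutElem c p X =
        cutElem c p (cutScale c p (ϖ := ϖ) e X) * leviZpowDiag c hϖ.ne_zero e := by
      rw [← leviZpowDiag_mul_cutElem_mul_inv c p hϖ.ne_zero e X, inv_mul_cancel_right]
    have hlevel : cutScale c p (ϖ := ϖ) e X ∈ cutLevel c p ϖ (t p) := by
      have h := cutScale_mem_cutLevel_of_gap c p hϖ.ne_zero hϖ.valuation_le_one
        (fun i j hij hi hj' => he i j hij (hi.trans hj'.symm)) hgap' hX
      rwa [add_sub_cancel] at h
    rw [map_sub, map_sub, ← Module.End.mul_apply, ← map_mul, hconj, map_mul, Module.End.mul_apply,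
      ht p _ hlevel, sub_self]
  -- hence kills `w ∈ W(U_{j p})`
  have hw := hj p hp hcp
  have key : ∀ y ∈ Submodule.span ℂ {y | ∃ X ∈ cutLevel c p ϖ (j p), ∃ v : W,
      y = τ (cutElem c p X) v - v}, φ (τ (leviZpowDiag c hϖ.ne_zero e) y) = 0 := by
    intro y hy
    induction hy using Submodule.span_induction with
    | mem y hy => exact hgen y hy
    | zero => rw [map_zero, map_zero]
    | add x y _ _ hx hy => rw [map_add, map_add, hx, hy, add_zero]
    | smul a x _ hx => rw [map_smul, map_smul, hx, smul_zero]
  exact key w hw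

/-! ### Step 2: uniformity over the `K₀`-orbits -/

/-- The dual action moves a smooth linear form inside the contragredient. [folklore] -/
lemma dual_mem_contragredient {φ : Module.Dual ℂ W} (hφ : φ ∈ τ.contragredient)
    (g : Π a, GL {i // c i = a} F) : τ.dual g φ ∈ τ.contragredient :=
  τ.contragredient.apply_mem_toSubmodule g hφ

omit [ValuativeRel F] [TopologicalSpace F] [IsNonarchimedeanLocalField F] in
/-- `φ (τ(k) y) = (τ^*(k⁻¹) φ) y`. [folklore] -/
lemma apply_apply_eq_dual_inv_apply (φ : Module.Dual ℂ W) (k : Π a, GL {i // c i = a} F) (y : W) :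
    φ (τ k y) = τ.dual k⁻¹ φ y := by
  rw [dual_apply, inv_inv, Module.Dual.transpose_apply, LinearMap.comp_apply]

/-- **Uniform gap bound.** For `τ` smooth and quasi-cuspidal at the cuts, `φ` smooth and `w`,
there is `G` such that `φ (τ(k₁ diag(ϖ^e) k₂) w) = 0` for all `k₁, k₂ ∈ K₀ = Π_a GL(B_a, 𝒪)` and
all `e` antitone on blocks with a gap `≥ G` at some proper cut. Indeed
`φ (τ(k₁ d k₂) w) = (τ^*(k₁⁻¹) φ)(τ(d) (τ(k₂) w))` and the `K₀`-orbits of `φ` and `w` are finite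
(`finite_orbit_of_isSmoothVector`), so the maximum of the bounds of Step 1 over the finitely many
pairs works. (Bernstein–Zelevinsky 1976, §3.21; Casselman 1995, Thm. 6.3.5.)
[cite: BernsteinZelevinsky1976, §3.18–3.21] -/
theorem exists_gap_uniform (hτ : τ.IsSmooth) {ϖ : F} (hϖ : IsUniformizingElement ϖ)
    (hQC : ∀ p q : Fin n, p < q → c q = c p →
      Coinvariants.ker (τ.comp (cutUnipotent F c p).subtype) = ⊤)
    {φ : Module.Dual ℂ W} (hφ : φ ∈ τ.contragredient) (w : W) :
    ∃ G : ℤ, ∀ k₁ ∈ leviIntegral F c, ∀ k₂ ∈ leviIntegral F c, ∀ e : Fin n → ℤ,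
      (∀ i j : Fin n, i ≤ j → c i = c j → e j ≤ e i) →
        ∀ (p : Fin n) (hp : p.1 + 1 < n), c ⟨p.1 + 1, hp⟩ = c p → e ⟨p.1 + 1, hp⟩ + G ≤ e p →
          φ (τ (k₁ * leviZpowDiag c hϖ.ne_zero e * k₂) w) = 0 := by
  haveI : IsTopologicalRing F := inferInstance
  -- the finite orbits
  set Oφ : Set (Module.Dual ℂ W) := (fun k : (Π a, GL {i // c i = a} F) => τ.dual k φ) ''
    (leviIntegral F c : Set _) with hOφ
  set Ow : Set W := (fun k : (Π a, GL {i // c i = a} F) => τ k w) '' (leviIntegral F c : Set _)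
    with hOw
  have hOφf : Oφ.Finite :=
    finite_orbit_of_isSmoothVector τ.dual (leviIntegral F c) (isCompact_leviIntegral F c)
      subset_rfl hφ
  have hOwf : Ow.Finite :=
    finite_orbit_of_isSmoothVector τ (leviIntegral F c) (isCompact_leviIntegral F c)
      subset_rfl (hτ w)
  -- Step 1 for every pair, with a vacuous bound outside the orbits
  have hpair : ∀ x : Module.Dual ℂ W × W, ∃ G : ℤ, x ∈ Oφ ×ˢ Ow →
      ∀ e : Fin n → ℤ, (∀ i j : Fin n, i ≤ j → c i = c j → e j ≤ e i) →
        ∀ (p : Fin n) (hp : p.1 + 1 < n), c ⟨p.1 + 1, hp⟩ = c p → e ⟨p.1 + 1, hp⟩ + G ≤ e p →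
          x.1 (τ (leviZpowDiag c hϖ.ne_zero e) x.2) = 0 := by
    rintro ⟨φ', w'⟩
    by_cases hx : (φ', w') ∈ Oφ ×ˢ Ow
    · obtain ⟨⟨k, -, rfl⟩, -⟩ := hx
      obtain ⟨G, hG⟩ := τ.exists_gap_forall_apply_eq_zero hϖ hQC (τ.dual_mem_contragredient hφ k) w'
      exact ⟨G, fun _ => hG⟩
    · exact ⟨0, fun h => absurd h hx⟩
  choose G hG using hpair
  refine ⟨(hOφf.prod hOwf).toFinset.sum fun x => |G x|, fun k₁ hk₁ k₂ hk₂ e he p hp hcp hgap => ?_⟩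
  have hmem : (τ.dual k₁⁻¹ φ, τ k₂ w) ∈ Oφ ×ˢ Ow :=
    ⟨⟨k₁⁻¹, inv_mem hk₁, rfl⟩, ⟨k₂, hk₂, rfl⟩⟩
  have hle : G (τ.dual k₁⁻¹ φ, τ k₂ w) ≤ (hOφf.prod hOwf).toFinset.sum fun x => |G x| :=
    (le_abs_self _).trans (Finset.single_le_sum (f := fun x => |G x|) (fun _ _ => abs_nonneg _)
      ((Set.Finite.mem_toFinset _).2 hmem))
  rw [map_mul, map_mul, Module.End.mul_apply, Module.End.mul_apply, apply_apply_eq_dual_inv_apply]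
  exact hG _ hmem e he p hp hcp (by omega)

/-! ### Step 3: the compact set -/

omit [TopologicalSpace F] [IsNonarchimedeanLocalField F] in
/-- Bounded consecutive gaps bound the drop along a block: if `e p ≤ e (p+1) + B` at every proper
cut then `e i ≤ e j + d • B` for `i ≤ j` in a common block at distance `d` (`c` monotone, so the
intermediate indices lie in the block). [folklore] -/
lemma apply_le_apply_add_of_gaps (hc : Monotone c) {e : Fin n → ℤ} {B : ℤ}
    (hgap : ∀ (p : Fin n) (hp : p.1 + 1 < n), c ⟨p.1 + 1, hp⟩ = c p → e p ≤ e ⟨p.1 + 1, hp⟩ + B) :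
    ∀ (d : ℕ) (i j : Fin n), j.1 = i.1 + d → c i = c j → e i ≤ e j + d * B := by
  intro d
  induction d with
  | zero =>
    intro i j hij _
    have : i = j := Fin.ext (by omega)
    subst this
    simp
  | succ d ih =>
    intro i j hij hcij
    have hi1 : i.1 + 1 < n := by have := j.2; omega
    have hci' : c ⟨i.1 + 1, hi1⟩ = c i := by
      refine le_antisymm ?_ (hc (Fin.le_def.2 (Nat.le_succ _)))
      rw [hcij]
      exact hc (Fin.le_def.2 (show i.1 + 1 ≤ j.1 by omega))
    have h1 := hgap i hi1 hci'
    have h2 := ih ⟨i.1 + 1, hi1⟩ j (show j.1 = (i.1 + 1) + d by omega) (hci'.trans hcij)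
    have h3 : ((d + 1 : ℕ) : ℤ) * B = (d : ℤ) * B + B := by push_cast; ring
    rw [h3]
    linarith

/-- **Harish-Chandra's support theorem for the Levi `Π_a GL(B_a, F)`.** A smooth representation
`τ` of the standard Levi (for a monotone block labelling `c`) whose coinvariants under every
proper cut unipotent group `cutUnipotent F c p` (`p < q` in the block of `p`) vanish — i.e. all
its proper "block" Jacquet modules are zero, `τ` is quasi-cuspidal — is **supercuspidal**: every
smooth matrix coefficient has compact support modulo the centre. With `G` from
`exists_gap_uniform`, a point `m = k₁ diag(ϖ^e) k₂` (Cartan decomposition,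
`exists_leviIntegral_mul_leviZpowDiag_mul`) where the coefficient does not vanish has all gaps of
`e` less than `G`, so `e = e₀ + z` with `z` constant on blocks (`diag(ϖ^z)` central) and
`e₀ ∈ [0, n|G|]^n`; hence `m ∈ (K₀ · diag(ϖ^{E_fin}) · K₀) · Z(M)`.
(Harish-Chandra 1970; Bernstein–Zelevinsky 1976, Thm. 3.21; Casselman 1995, Thm. 5.3.1, 6.3.5;
Bushnell–Henniart 2006, §10.1.) [cite: BernsteinZelevinsky1976, §3.18–3.21] -/
theorem isSupercuspidal_of_forall_cut (hc : Monotone c) (hτ : τ.IsSmooth)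
    (hQC : ∀ p q : Fin n, p < q → c q = c p →
      Coinvariants.ker (τ.comp (cutUnipotent F c p).subtype) = ⊤) :
    τ.IsSupercuspidal := by
  haveI : IsTopologicalRing F := inferInstance
  intro φ hφ w
  obtain ⟨ϖ, hϖ⟩ := exists_isUniformizingElement (F := F)
  obtain ⟨G, hG⟩ := τ.exists_gap_uniform hτ hϖ hQC hφ w
  -- the finite set of normalised exponents and the compact set
  set E : Set (Fin n → ℤ) := {e | ∀ i, e i ∈ Set.Icc (0 : ℤ) (n * |G|)} with hE
  have hEf : E.Finite := Set.Finite.pi' fun _ => Set.finite_Icc _ _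
  set K : Set (Π a, GL {i // c i = a} F) :=
    ((leviIntegral F c : Subgroup (Π a, GL {i // c i = a} F)) : Set (Π a, GL {i // c i = a} F)) with hK
  set D : Set (Π a, GL {i // c i = a} F) := (fun e => leviZpowDiag c hϖ.ne_zero e) '' E with hD
  refine ⟨K * D * K, ((isCompact_leviIntegral F c).mul (hEf.image _).isCompact).mul
    (isCompact_leviIntegral F c), fun m hm => ?_⟩
  rw [Function.mem_support, matrixCoeff_apply] at hm
  -- Cartan decomposition of `m`
  obtain ⟨k₁, hk₁, k₂, hk₂, e, he, rfl⟩ := exists_leviIntegral_mul_leviZpowDiag_mul c hϖ m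
  -- all gaps of `e` are `< G`
  have hgap : ∀ (p : Fin n) (hp : p.1 + 1 < n), c ⟨p.1 + 1, hp⟩ = c p →
      e p ≤ e ⟨p.1 + 1, hp⟩ + |G| := by
    intro p hp hcp
    by_contra h
    exact hm (hG k₁ hk₁ k₂ hk₂ e he p hp hcp (by have := le_abs_self G; omega))
  -- the last index of each block and the normalisation
  obtain ⟨last, hlast⟩ : ∃ last : Fin n → Fin n,
      ∀ i, last i = (Finset.univ.filter fun j => c j = c i).max' ⟨i, by simp⟩ := ⟨_, fun _ => rfl⟩
  have hlast_mem : ∀ i, c (last i) = c i := fun i => by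
    have h := Finset.max'_mem (Finset.univ.filter fun j => c j = c i) ⟨i, by simp⟩
    rw [← hlast i] at h
    simpa using h
  have hle_last : ∀ i, i ≤ last i := fun i => by
    rw [hlast i]
    exact Finset.le_max' _ _ (by simp)
  have hlast_eq : ∀ i j, c i = c j → last i = last j := fun i j hij => by
    rw [hlast i, hlast j]
    congr 1
    ext k
    simp [hij]
  obtain ⟨z, hz⟩ : ∃ z : Fin n → ℤ, ∀ i, z i = e (last i) := ⟨_, fun _ => rfl⟩
  obtain ⟨e₀, he₀⟩ : ∃ e₀ : Fin n → ℤ, ∀ i, e₀ i = e i - e (last i) := ⟨_, fun _ => rfl⟩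
  have hzc : ∀ i j : Fin n, c i = c j → z i = z j := fun i j hij => by
    rw [hz, hz, hlast_eq i j hij]
  have he₀E : e₀ ∈ E := by
    intro i
    refine ⟨?_, ?_⟩
    · have := he i (last i) (hle_last i) (hlast_mem i).symm
      rw [he₀]; omega
    · obtain ⟨d, hd⟩ : ∃ d : ℕ, (last i).1 = i.1 + d := ⟨(last i).1 - i.1, by
        have := Fin.le_def.1 (hle_last i); omega⟩
      have h1 := apply_le_apply_add_of_gaps hc hgap d i (last i) hd (hlast_mem i).symm
      have hdn : (d : ℤ) ≤ n := by have := (last i).2; omega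
      have hGn : (d : ℤ) * |G| ≤ n * |G| := mul_le_mul_of_nonneg_right hdn (abs_nonneg G)
      rw [he₀]
      linarith
  have hsplit : e = e₀ + z := by
    funext i
    rw [Pi.add_apply, he₀, hz]
    ring
  -- `m = (k₁ diag(ϖ^{e₀}) k₂) · diag(ϖ^z)` with the second factor central
  have hzcen : leviZpowDiag c hϖ.ne_zero z ∈ Subgroup.center (Π a, GL {i // c i = a} F) :=
    leviZpowDiag_mem_center c hϖ.ne_zero hzc
  have hcomm : leviZpowDiag c hϖ.ne_zero z * k₂ = k₂ * leviZpowDiag c hϖ.ne_zero z :=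
    (Subgroup.mem_center_iff.1 hzcen k₂).symm
  refine Set.mem_mul.2 ⟨k₁ * leviZpowDiag c hϖ.ne_zero e₀ * k₂,
    Set.mul_mem_mul (Set.mul_mem_mul hk₁ ⟨e₀, he₀E, rfl⟩) hk₂, leviZpowDiag c hϖ.ne_zero z, hzcen, ?_⟩
  rw [hsplit, leviZpowDiag_add]
  simp only [mul_assoc, hcomm]

end Representation
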